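import Literature.NumberTheory.BeurlingPrimes.HilberdinkLogDeriv
import Literature.NumberTheory.BeurlingPrimes.IntegerContinuation
import Mathlib.Analysis.Complex.HasPrimitives
import HarnessLib

/-!
# `ψ_P(x) = x + O(x^θ)` makes the continued `ζ_P` zero-free on `Re s > θ` (Hilberdink–Lapidus, Thm. 2.1)

Topic `Literature/NumberTheory/BeurlingPrimes`. Everything in this file is PROVED.

Hilberdink–Lapidus 2006, proof of Theorem 2.1 (first half): "`φ(s) = s/(s−1) + s∫₁^∞ r(x)x^{−s−1} dx`
… provides the analytic continuation of `φ(s)` [`= −ζ'/ζ`] to `{Re s > α}` except for a simple pole at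
`s = 1` with residue `1`. By standard complex analysis, it follows that `ζ(s)` has an analytic
continuation … Moreover, it has no zeros in this region, for if it did, then `φ(s) = ζ'(s)/ζ(s)`
would have a singularity."

Here the continuation of `ζ_P` is taken from the integers (`BeurlingPrimes.intZeta`, tree
`IntegerContinuation.lean`, under `|N_P(x) − ρx| ≤ Cx^β`), the continuation `F̃(s)/(s−1)` of `φ`
from the tree's `HilberdinkLogDeriv.lean` (`Hilberdink.Ftilde`, `Hilberdink.hasDerivAt_eulerLog`:
`ζ_P = exp L`, `L' = −φ` on `Re s > 1`), and "would have a singularity" is made precise as the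
uniqueness theorem for the linear ODE `Z' = −φZ`:

* `eqOn_zero_of_deriv_eq_neg_mul` — if `Z`, `Φ` are holomorphic on an open preconnected `U`,
  `Z' = −ΦZ` on `U` and `Z(s₀) = 0` for one `s₀ ∈ U`, then `Z ≡ 0` on `U` (locally
  `(Z e^{∫Φ})' = 0` on a disc, then the identity theorem);
* `deriv_intZeta_eq` — `Z' = −(F̃/(s−1))·Z` on `{Re s > max(β, θ)} ∖ {1}` (true on `Re s > 1` by the
  Euler product, extended by the identity theorem);
* `intZeta_ne_zero_of_psi` — hence `Z(s) ≠ 0` for `Re s > max(β, θ)`, `s ≠ 1`; and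
  `IsZetaContinuation.ne_zero_of_primeErrorLE` — the same for every continuation of `ζ_P`
  (uniqueness, `IsZetaContinuation.eqOn`).

This discharges, for systems whose integers are also regular, the use of the named fact
`HilberdinkLapidus2006_thm21` in Hilberdink's Corollary 2(b)
(`Literature/Barriers/RiemannHypothesis/BeurlingCounterexamplesProofs.lean`).

## References
* [HilberdinkLapidus2006] T. W. Hilberdink, M. L. Lapidus, *Beurling zeta functions, generalised
  primes, and fractal membranes*, Acta Appl. Math. 94 (2006) 21–48, arXiv:math/0410270, Thm. 2.1 and
  its proof (read).
-/

noncomputable section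

open Set Filter Complex Topology Metric

namespace Literature.NumberTheory.BeurlingPrimes

open Literature.Barriers.RiemannHypothesis

/-! ### Uniqueness for the linear ODE `Z' = −ΦZ` -/

/-- **Zeros of solutions of `Z' = −ΦZ` propagate**: if `Z`, `Φ` are holomorphic on an open
preconnected set `U`, `deriv Z = −Φ·Z` on `U`, and `Z(s₀) = 0` for some `s₀ ∈ U`, then `Z = 0` on
`U`. (On a disc around `s₀` let `G` be a primitive of `Φ` (Mathlib `DifferentiableOn.isExactOn_ball`);
`(Z e^{G})' = 0`, so `Z e^{G}` is constant `= 0`; then the identity theorem.) [folklore] -/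
theorem eqOn_zero_of_deriv_eq_neg_mul {U : Set ℂ} (hU : IsOpen U) (hUc : IsPreconnected U)
    {Z Φ : ℂ → ℂ} (hZ : DifferentiableOn ℂ Z U) (hΦ : DifferentiableOn ℂ Φ U)
    (h : ∀ z ∈ U, deriv Z z = -(Φ z * Z z)) {s₀ : ℂ} (hs₀ : s₀ ∈ U) (h0 : Z s₀ = 0) :
    EqOn Z 0 U := by
  obtain ⟨r, hr, hball⟩ := Metric.isOpen_iff.mp hU s₀ hs₀
  -- a primitive of `Φ` on the disc
  obtain ⟨G, hG⟩ := (hΦ.mono hball).isExactOn_ball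
  -- `W = Z · exp G` has zero derivative on the disc
  set W : ℂ → ℂ := fun z ↦ Z z * Complex.exp (G z) with hW
  have hWd : ∀ z ∈ ball s₀ r, HasDerivAt W 0 z := by
    intro z hz
    have hZz : HasDerivAt Z (deriv Z z) z :=
      (hZ.differentiableAt (hU.mem_nhds (hball hz))).hasDerivAt
    have hEz : HasDerivAt (fun w ↦ Complex.exp (G w)) (Complex.exp (G z) * Φ z) z := (hG z hz).cexp
    have hprod := hZz.mul hEz
    have hzero : deriv Z z * Complex.exp (G z) + Z z * (Complex.exp (G z) * Φ z) = 0 := by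
      rw [h z (hball hz)]
      ring
    rw [hzero] at hprod
    exact hprod
  have hWdiff : DifferentiableOn ℂ W (ball s₀ r) := fun z hz ↦
    (hWd z hz).differentiableAt.differentiableWithinAt
  have hWconst : ∀ z ∈ ball s₀ r, W z = W s₀ := fun z hz ↦
    isOpen_ball.is_const_of_deriv_eq_zero (convex_ball s₀ r).isPreconnected hWdiff
      (fun w hw ↦ (hWd w hw).deriv) hz (mem_ball_self hr)
  have hW0 : W s₀ = 0 := by simp [hW, h0]
  -- so `Z = 0` on the disc, hence near `s₀`
  have hev : Z =ᶠ[𝓝 s₀] 0 := by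
    filter_upwards [isOpen_ball.mem_nhds (mem_ball_self hr)] with z hz
    have hWz : Z z * Complex.exp (G z) = 0 := by
      have := hWconst z hz
      rw [hW0] at this
      exact this
    simpa [Complex.exp_ne_zero] using hWz
  exact (hZ.analyticOnNhd hU).eqOn_zero_of_preconnected_of_eventuallyEq_zero hUc hs₀ hev

/-! ### `Z' = −φZ` for the continued `ζ_P` -/

variable {P : BeurlingPrimes}

/-- On `Re s > 1`: `Z'(s) = −φ(s)Z(s)`, where `Z = intZeta = ζ_P = exp L` and `L' = −φ`
(`φ = Hilberdink.vonMangoldtSeries`). [cite: HilberdinkLapidus2006, §2.1] -/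
theorem deriv_intZeta_eq_of_one_lt {ρ C β : ℝ} (hβ : β < 1)
    (hN : ∀ x : ℝ, 1 ≤ x → |(P.intCount x : ℝ) - ρ * x| ≤ C * x ^ β) {s : ℂ} (hs : 1 < s.re) :
    deriv (P.intZeta ρ) s = -(Hilberdink.vonMangoldtSeries P s * P.intZeta ρ s) := by
  have hB := Hilberdink.intCount_le_of_abs_le P hβ.le hN
  -- `Z = exp ∘ L` near `s`
  have hev : P.intZeta ρ =ᶠ[𝓝 s] fun w ↦ Complex.exp (Hilberdink.eulerLog P w) := by
    filter_upwards [(isOpen_lt continuous_const continuous_re).mem_nhds hs] with w hw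
    rw [intZeta_eq_zeta hβ hN hw, Hilberdink.zeta_eq_exp_eulerLog P hB hw]
  obtain ⟨hLd, hLderiv⟩ := Hilberdink.hasDerivAt_eulerLog hB hs
  have hexp : HasDerivAt (fun w ↦ Complex.exp (Hilberdink.eulerLog P w))
      (Complex.exp (Hilberdink.eulerLog P s) * deriv (Hilberdink.eulerLog P) s) s :=
    hLd.hasDerivAt.cexp
  rw [hev.deriv_eq, hexp.deriv, hLderiv, intZeta_eq_zeta hβ hN hs,
    Hilberdink.zeta_eq_exp_eulerLog P hB hs]
  ring

/-- The continuation `F̃(s)/(s − 1)` of `φ` is holomorphic on `{Re s > θ} ∖ {1}`.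
[cite: HilberdinkLapidus2006, §2.1] -/
theorem differentiableOn_Ftilde_div {C' θ : ℝ}
    (hψ : ∀ x : ℝ, 1 ≤ x → |P.chebyshevPsi x - x| ≤ C' * x ^ θ) :
    DifferentiableOn ℂ (fun s ↦ Hilberdink.Ftilde P s / (s - 1)) {s : ℂ | θ < s.re ∧ s ≠ 1} :=
  ((Hilberdink.differentiableOn_Ftilde hψ).mono fun _ hs ↦ hs.1).div
    (differentiableOn_id.sub (differentiableOn_const _)) fun _ hs ↦ sub_ne_zero.mpr hs.2

/-- **`Z' = −(F̃/(s−1))·Z` on `{Re s > max(β, θ)} ∖ {1}`** (the identity of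
`deriv_intZeta_eq_of_one_lt` continued analytically: both sides are holomorphic there and agree on
`Re s > 1`). [cite: HilberdinkLapidus2006, proof of Thm 2.1] -/
theorem deriv_intZeta_eq {ρ C β C' θ : ℝ} (hβ : β < 1)
    (hN : ∀ x : ℝ, 1 ≤ x → |(P.intCount x : ℝ) - ρ * x| ≤ C * x ^ β) (hθ : θ < 1)
    (hψ : ∀ x : ℝ, 1 ≤ x → |P.chebyshevPsi x - x| ≤ C' * x ^ θ) {s : ℂ} (hs : max β θ < s.re)
    (hs1 : s ≠ 1) :
    deriv (P.intZeta ρ) s = -(Hilberdink.Ftilde P s / (s - 1) * P.intZeta ρ s) := by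
  set U : Set ℂ := {s : ℂ | max β θ < s.re ∧ s ≠ 1} with hUdef
  have hU : IsOpen U := (isOpen_lt continuous_const continuous_re).inter isOpen_ne
  have hB := Hilberdink.intCount_le_of_abs_le P hβ.le hN
  have hZ : DifferentiableOn ℂ (P.intZeta ρ) U :=
    (differentiableOn_intZeta hN).mono fun _ hz ↦ ⟨(le_max_left β θ).trans_lt hz.1, hz.2⟩
  have hΦ : DifferentiableOn ℂ (fun s ↦ Hilberdink.Ftilde P s / (s - 1)) U :=
    (differentiableOn_Ftilde_div hψ).mono fun _ hz ↦ ⟨(le_max_right β θ).trans_lt hz.1, hz.2⟩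
  -- `H = Z' + Φ Z` is analytic on `U` and vanishes on `Re s > 1`
  set H : ℂ → ℂ := fun s ↦ deriv (P.intZeta ρ) s + Hilberdink.Ftilde P s / (s - 1) * P.intZeta ρ s
    with hHdef
  have hHa : AnalyticOnNhd ℂ H U :=
    ((hZ.analyticOnNhd hU).deriv).add ((hΦ.analyticOnNhd hU).mul (hZ.analyticOnNhd hU))
  set z₀ : ℂ := ((max (max β θ) 1 + 1 : ℝ) : ℂ) with hz₀
  have hz₀re : z₀.re = max (max β θ) 1 + 1 := by simp [hz₀]
  have hz₀1 : 1 < z₀.re := by rw [hz₀re]; linarith [le_max_right (max β θ) 1]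
  have hz₀U : z₀ ∈ U := by
    refine ⟨by rw [hz₀re]; linarith [le_max_left (max β θ) 1], fun h1 ↦ ?_⟩
    have := congrArg Complex.re h1
    rw [one_re] at this
    linarith
  have hHev : H =ᶠ[𝓝 z₀] 0 := by
    filter_upwards [(isOpen_lt continuous_const continuous_re).mem_nhds hz₀1] with w hw
    have hw1 : w - 1 ≠ 0 := by
      intro h0
      have := congrArg Complex.re h0
      simp at this
      linarith
    simp only [hHdef, Pi.zero_apply]
    rw [deriv_intZeta_eq_of_one_lt hβ hN hw, Hilberdink.Ftilde_eq_of_one_lt hB hθ.le hψ hw]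
    field_simp
    ring
  have hH0 := hHa.eqOn_zero_of_preconnected_of_eventuallyEq_zero
    (isPreconnected_puncturedHalfPlane (max β θ)) hz₀U hHev
  have := hH0 ⟨hs, hs1⟩
  simp only [hHdef, Pi.zero_apply] at this
  linear_combination this

/-! ### Zero-freeness -/

/-- **`Z(s) ≠ 0` for `Re s > max(β, θ)`, `s ≠ 1`**, when `|N_P(x) − ρx| ≤ Cx^β` (`β < 1`) and
`|ψ_P(x) − x| ≤ C'x^θ` (`θ < 1`): a zero would propagate along `Z' = −φZ` to all of the punctured
half-plane (`eqOn_zero_of_deriv_eq_neg_mul`), contradicting `ζ_P(2) ≠ 0` (Euler product).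
[cite: HilberdinkLapidus2006, Thm 2.1] -/
theorem intZeta_ne_zero_of_psi {ρ C β C' θ : ℝ} (hβ : β < 1)
    (hN : ∀ x : ℝ, 1 ≤ x → |(P.intCount x : ℝ) - ρ * x| ≤ C * x ^ β) (hθ : θ < 1)
    (hψ : ∀ x : ℝ, 1 ≤ x → |P.chebyshevPsi x - x| ≤ C' * x ^ θ) {s : ℂ} (hs : max β θ < s.re)
    (hs1 : s ≠ 1) : P.intZeta ρ s ≠ 0 := by
  intro h0
  set U : Set ℂ := {s : ℂ | max β θ < s.re ∧ s ≠ 1} with hUdef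
  have hU : IsOpen U := (isOpen_lt continuous_const continuous_re).inter isOpen_ne
  have hB := Hilberdink.intCount_le_of_abs_le P hβ.le hN
  have hZ : DifferentiableOn ℂ (P.intZeta ρ) U :=
    (differentiableOn_intZeta hN).mono fun _ hz ↦ ⟨(le_max_left β θ).trans_lt hz.1, hz.2⟩
  have hΦ : DifferentiableOn ℂ (fun s ↦ Hilberdink.Ftilde P s / (s - 1)) U :=
    (differentiableOn_Ftilde_div hψ).mono fun _ hz ↦ ⟨(le_max_right β θ).trans_lt hz.1, hz.2⟩
  have hall := eqOn_zero_of_deriv_eq_neg_mul hU (isPreconnected_puncturedHalfPlane (max β θ)) hZ hΦ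
    (fun z hz ↦ deriv_intZeta_eq hβ hN hθ hψ hz.1 hz.2) ⟨hs, hs1⟩ h0
  -- but `Z(z₀) = ζ_P(z₀) ≠ 0` at a real point `z₀ > 1`
  set z₀ : ℂ := ((max (max β θ) 1 + 1 : ℝ) : ℂ) with hz₀
  have hz₀re : z₀.re = max (max β θ) 1 + 1 := by simp [hz₀]
  have hz₀1 : 1 < z₀.re := by rw [hz₀re]; linarith [le_max_right (max β θ) 1]
  have hz₀U : z₀ ∈ U := by
    refine ⟨by rw [hz₀re]; linarith [le_max_left (max β θ) 1], fun h1 ↦ ?_⟩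
    have := congrArg Complex.re h1
    rw [one_re] at this
    linarith
  have hZz₀ : P.intZeta ρ z₀ = 0 := hall hz₀U
  rw [intZeta_eq_zeta hβ hN hz₀1] at hZz₀
  exact P.zeta_ne_zero (by linarith) (Hilberdink.summable_prime_rpow P hB hz₀1) hZz₀

/-- **Every continuation of `ζ_P` is zero-free on `{Re s > max(β, θ)} ∖ {1}`** under
`IntErrorLE P ρ β` (`β < 1`) and `PrimeErrorLE P θ` (`θ < 1`) (uniqueness of the continuation,
`IsZetaContinuation.eqOn`). [cite: HilberdinkLapidus2006, Thm 2.1] -/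
theorem _root_.Literature.Barriers.RiemannHypothesis.BeurlingPrimes.IsZetaContinuation.ne_zero_of_primeErrorLE
    {ρ β θ : ℝ} (hβ : β < 1) (hN : P.IntErrorLE ρ β) (hθ : θ < 1) (hψ : P.PrimeErrorLE θ)
    {Z : ℂ → ℂ} (hZ : P.IsZetaContinuation β Z) {s : ℂ} (hs : max β θ < s.re) (hs1 : s ≠ 1) :
    Z s ≠ 0 := by
  obtain ⟨C, hC⟩ := hN
  obtain ⟨C', hC'⟩ := hψ
  have heq := (isZetaContinuation_intZeta hβ hC).eqOn hZ
  rw [← heq ⟨(le_max_left β θ).trans_lt hs, hs1⟩]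
  exact intZeta_ne_zero_of_psi hβ hC hθ hC' hs hs1

end Literature.NumberTheory.BeurlingPrimes

end
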